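import Summits.FinalStateConjecture.FinalStateConjecture.Theorems.ZeroEnergyKerrOrBombStationaryLimitReductionRecutCoveringJunctionCore
import HarnessLib

/-!
# Route ZeroEnergyKerrOrBomb · crux `FinalStateFromKerrOrBomb` (stmt-FinalStateConjecture-17839), line `SketchIdeator1` —
# stub `stub_recutJunctionCoreB` (m5, boost-honest junction core), wave 7, bricks B1a/B1b: LAB TIME OF CERTIFIED HOLE
# COORDINATES and ORTHOCHRONY of the motions from (ℓ) + (e′)

Helper file (`--supports stmt-FinalStateConjecture-17839`; registered helpers `recutJunction_orthochronous`,
`recutJunction_labTime_sandwich`, `recutJunction_labTime_of_certified`, `recutJunction_time_le_labTime`,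
`recutJunction_time_ge_of_labTime`) of the lead's wave-7 stub worker W18 (2026-08-17); plan
`work/stubs/W17-boost-audit.md` §5.3, §7.2 (Steps 0/T/F), §7.3 (brick ledger, rows B1a/B1b). Report `work/stubs/W18-report.md`.

For the motion `(Λᵢ, cᵢ)` of hole `i` write `γᵢ := (Λᵢ e₀)⁰` and `uᵢ := √(γᵢ² − 1)`; the moved adapted background of hole `i`
has REST time `timeᵢ y = (Λᵢ⁻¹(y − cᵢ))⁰` and REST radius `radiusᵢ y = Aᵢ.radius (Λᵢ⁻¹(y − cᵢ))`, total functions on `E4`,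
with `|Aᵢ.radius − ‖·‖_{space}| ≤ C` (`AdaptedChart.exists_abs_radius_sub_spatialNorm_le`). The Lorentz time sandwich
(brick B1, p152127, private copies here) gives, for EVERY coordinate `y : E4`,
  `|y⁰ − cᵢ⁰ − γᵢ · timeᵢ y| ≤ uᵢ (radiusᵢ y + C)`                                  (`recutJunction_labTime_sandwich`, B1a),
hence on CERTIFIED coordinates (`radiusᵢ y ≤ Rᵢ (timeᵢ y)`) with SUBLINEAR radii (`Rᵢ τ / τ → 0`, clause (o)):
* `|y⁰ − γᵢ t| ≤ ε t` eventually in the rest time `t = timeᵢ y` (`recutJunction_labTime_of_certified`; with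
  `1 ≤ γᵢ ≤ γ_max` this is the level-shift estimate of Step 0: rest time `τ₁/(2γ_max)` means lab time `≤ τ₁/2 + o(τ₁)` and
  `≥ τ₁/(4γ_max)`),
* `timeᵢ y ≤ y⁰ + |cᵢ⁰| + 1` eventually in the LAB time `y⁰` (`recutJunction_time_le_labTime`, B1b; `γᵢ ≥ 1`),
* `timeᵢ y ≥ T*` eventually in the lab time, for every `T*` (`recutJunction_time_ge_of_labTime`; `γᵢ ≥ 1`, no (o)),
and `γᵢ ≥ 1` (orthochrony) follows from the Kerr identification (`cᵢ = 1`), (e′) `ρᵢ → ∞` and (ℓ) alone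
(`recutJunction_orthochronous`): sliding an identification point backwards in Kerr–Schild time keeps its adapted radius, and
for `γᵢ ≤ −1` makes its lab time `→ +∞` while its rest time `→ −∞`, contradicting (ℓ). Isochrony `Λᵢ e₀ = e₀` is used
nowhere. Elementary; no named fact, nothing restated. References: O'Neill 1983, Ch. 9, pp. 233–236; Dafermos–Luk
arXiv:1710.01722, Conjecture 1 (b)–(c) (late-time multi-chart bookkeeping; formalisation-internal).
-/

set_option linter.dupNamespace false
set_option maxSynthPendingDepth 3

noncomputable section

open scoped Manifold ContDiff Topology RealInnerProductSpace
open Set Filter Function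

namespace Summit.FinalStateConjecture.FinalStateConjecture.Theorems.SymplecticDualOfTheBomb

open Literature.Geometry.Lorentzian Summit.FinalStateConjecture.FinalStateConjecture.Theorems.OneLockedExplosion

/-! ## §1 The Lorentz time sandwich (private copies of brick B1, p152127, module unbuilt today) -/

section Lorentz

variable (Λ : lorentzGroup)

/-- `η(v, w) = −v⁰ w⁰ + ⟪v_{space}, w_{space}⟫`. O'Neill 1983, Ch. 3, p. 55. [folklore] -/
private theorem minkowski_eq_inner_w7 (v w : E4) :
    Minkowski.bilin v w = -(v 0 * w 0) + ⟪E4.spatial v, E4.spatial w⟫ := by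
  -- private copy of `minkowski_eq_inner_w17` (…BoostAuditLorentz, unbuilt today)
  rw [Minkowski.bilin_apply, real_inner_comm, PiLp.inner_apply]
  simp [Fin.sum_univ_three, E4.spatial_apply]

/-- The time axis has no spatial part: `(e₀)_{space} = 0`. [folklore] -/
private theorem spatial_basisVector_zero_w7 : E4.spatial (E4.basisVector 0) = 0 := by
  ext i
  simp [E4.basisVector]

/-- `(e₀)⁰ = 1`. [folklore] -/
private theorem basisVector_zero_apply_zero_w7 : (E4.basisVector 0 : E4) 0 = 1 := by
  simp [E4.basisVector]

/-- Lab time through the pulled-back time axis: `(Λ w)⁰ = ũ⁰ w⁰ − ⟪ũ_{space}, w_{space}⟫`, `ũ := Λ⁻¹ e₀`.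
O'Neill 1983, Ch. 9, p. 233. [folklore] -/
private theorem lorentz_apply_zero_eq_w7 (w : E4) :
    (Λ : E4 ≃L[ℝ] E4) w 0 = (Λ : E4 ≃L[ℝ] E4).symm (E4.basisVector 0) 0 * w 0 -
      ⟪E4.spatial ((Λ : E4 ≃L[ℝ] E4).symm (E4.basisVector 0)), E4.spatial w⟫ := by
  -- private copy of `lorentz_apply_zero_eq_w17` (…BoostAuditLorentz, unbuilt today)
  have h := Λ.2 ((Λ : E4 ≃L[ℝ] E4).symm (E4.basisVector 0)) w
  rw [ContinuousLinearEquiv.apply_symm_apply, Minkowski.bilin_basisVector_zero_left, minkowski_eq_inner_w7] at h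
  linarith

/-- `(Λ⁻¹ e₀)⁰ = (Λ e₀)⁰`. O'Neill 1983, Ch. 9, p. 233. [folklore] -/
private theorem lorentz_symm_basisVector_apply_zero_w7 :
    (Λ : E4 ≃L[ℝ] E4).symm (E4.basisVector 0) 0 = (Λ : E4 ≃L[ℝ] E4) (E4.basisVector 0) 0 := by
  -- private copy of `lorentz_symm_basisVector_apply_zero` (…BoostAuditLorentz, unbuilt today)
  have h := lorentz_apply_zero_eq_w7 Λ (E4.basisVector 0)
  rw [spatial_basisVector_zero_w7, inner_zero_right, sub_zero, basisVector_zero_apply_zero_w7, mul_one] at h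
  exact h.symm

/-- `‖(Λ⁻¹ e₀)_{space}‖² = ((Λ e₀)⁰)² − 1`. O'Neill 1983, Ch. 9, p. 233. [folklore] -/
private theorem lorentz_symm_basisVector_spatialNorm_sq_w7 :
    E4.spatialNorm ((Λ : E4 ≃L[ℝ] E4).symm (E4.basisVector 0)) ^ 2 =
      ((Λ : E4 ≃L[ℝ] E4) (E4.basisVector 0) 0) ^ 2 - 1 := by
  -- private copy of `lorentz_symm_basisVector_spatialNorm_sq` (…BoostAuditLorentz, unbuilt today)
  have h := Λ.2 ((Λ : E4 ≃L[ℝ] E4).symm (E4.basisVector 0)) ((Λ : E4 ≃L[ℝ] E4).symm (E4.basisVector 0))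
  rw [ContinuousLinearEquiv.apply_symm_apply, Minkowski.bilin_basisVector_zero, minkowski_eq_inner_w7,
    real_inner_self_eq_norm_sq, lorentz_symm_basisVector_apply_zero_w7] at h
  rw [E4.spatialNorm]
  linarith

/-- **Lorentz time sandwich**: `|(Λ w)⁰ − γ w⁰| ≤ √(γ² − 1) ‖w_{space}‖`, `γ = (Λ e₀)⁰`. O'Neill 1983, Ch. 9,
pp. 233–236. [folklore] -/
private theorem lorentz_time_sandwich_w7 (w : E4) :
    |(Λ : E4 ≃L[ℝ] E4) w 0 - (Λ : E4 ≃L[ℝ] E4) (E4.basisVector 0) 0 * w 0| ≤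
      √(((Λ : E4 ≃L[ℝ] E4) (E4.basisVector 0) 0) ^ 2 - 1) * E4.spatialNorm w := by
  -- private copy of `lorentz_time_sandwich` (…BoostAuditLorentz, p152127, unbuilt today)
  have hsp : E4.spatialNorm ((Λ : E4 ≃L[ℝ] E4).symm (E4.basisVector 0)) =
      √(((Λ : E4 ≃L[ℝ] E4) (E4.basisVector 0) 0) ^ 2 - 1) := by
    rw [← lorentz_symm_basisVector_spatialNorm_sq_w7, Real.sqrt_sq (E4.spatialNorm_nonneg _)]
  rw [lorentz_apply_zero_eq_w7, lorentz_symm_basisVector_apply_zero_w7, ← hsp]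
  have h := abs_real_inner_le_norm (E4.spatial ((Λ : E4 ≃L[ℝ] E4).symm (E4.basisVector 0))) (E4.spatial w)
  rw [show (Λ : E4 ≃L[ℝ] E4) (E4.basisVector 0) 0 * w 0 -
      ⟪E4.spatial ((Λ : E4 ≃L[ℝ] E4).symm (E4.basisVector 0)), E4.spatial w⟫ -
        (Λ : E4 ≃L[ℝ] E4) (E4.basisVector 0) 0 * w 0 =
      -⟪E4.spatial ((Λ : E4 ≃L[ℝ] E4).symm (E4.basisVector 0)), E4.spatial w⟫ by ring, abs_neg]
  simpa [E4.spatialNorm] using h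

/-- **Rest time from lab time** (`poincareInv` form of the sandwich): `|x⁰ − c⁰ − γ (Λ⁻¹(x − c))⁰| ≤
√(γ² − 1) ‖(Λ⁻¹(x − c))_{space}‖`. O'Neill 1983, Ch. 9, p. 236. [folklore] -/
private theorem poincareInv_time_sandwich_w7 (c x : E4) :
    |x 0 - c 0 - (Λ : E4 ≃L[ℝ] E4) (E4.basisVector 0) 0 * poincareInv Λ c x 0| ≤
      √(((Λ : E4 ≃L[ℝ] E4) (E4.basisVector 0) 0) ^ 2 - 1) * E4.spatialNorm (poincareInv Λ c x) := by
  -- private copy of `poincareInv_time_sandwich` (…BoostAuditLorentz, p152127, unbuilt today)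
  have h := lorentz_time_sandwich_w7 Λ (poincareInv Λ c x)
  have hx : (Λ : E4 ≃L[ℝ] E4) (poincareInv Λ c x) = x - c := by
    rw [poincareInv, ContinuousLinearEquiv.apply_symm_apply]
  rw [hx, PiLp.sub_apply] at h
  exact h

/-- The Lorentz factor is `≥ 1` or `≤ −1`: `((Λ e₀)⁰)² ≥ 1`. O'Neill 1983, Ch. 9, p. 233. [folklore] -/
private theorem one_le_lorentz_basisVector_zero_sq_w7 : 1 ≤ ((Λ : E4 ≃L[ℝ] E4) (E4.basisVector 0) 0) ^ 2 := by
  have h := lorentz_symm_basisVector_spatialNorm_sq_w7 Λ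
  nlinarith [sq_nonneg (E4.spatialNorm ((Λ : E4 ≃L[ℝ] E4).symm (E4.basisVector 0)))]

end Lorentz

/-! ## §2 Orthochrony of the motions from (ℓ) + (e′) -/

section Ortho

variable {𝓢 : Spacetime.{0} 4} {O : Set 𝓢.carrier} {k : ℕ}

/-- Far points of the Kerr–Schild chart: for every `ρ₀` there is `u` with `r(u) ≥ ρ₀`. [folklore] -/
private theorem exists_radius_ge_w7 (a ρ₀ : ℝ) : ∃ u : E4, ρ₀ ≤ Kerr.radius a u := by
  -- private copy of `exists_radius_ge_w5s` (…RecutCoreCOIsochronousSign, unbuilt today)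
  set y : E3 := EuclideanSpace.single 0 (|ρ₀| + |a|) with hy
  have hny : ‖y‖ = |ρ₀| + |a| := by
    rw [hy, EuclideanSpace.single, PiLp.norm_single, Real.norm_eq_abs, abs_of_nonneg (by positivity)]
  refine ⟨E4.ofTimeSpace 0 y, ?_⟩
  have h1 := Kerr.spatialNorm_sq_sub_sq_le_radius_sq a (E4.ofTimeSpace 0 y)
  rw [E4.spatialNorm_ofTimeSpace, hny] at h1
  have h2 : ρ₀ ^ 2 ≤ Kerr.radius a (E4.ofTimeSpace 0 y) ^ 2 := by
    nlinarith [abs_nonneg ρ₀, abs_nonneg a, sq_abs ρ₀, sq_abs a]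
  nlinarith [Kerr.radius_nonneg a (E4.ofTimeSpace 0 y), le_abs_self ρ₀, abs_nonneg ρ₀]

/-- **An anti-orthochronous motion contradicts (ℓ) + (e′).** If `γᵢ = (Λᵢ e₀)⁰ ≤ −1`, the identification points
`Pᵢ Θᵢ (x − s e₀)` (`s → ∞`) have constant adapted radius (`≤ ρᵢ(lab time) + 1` eventually, by (e′)), lab time
`≥ const + s → +∞` and rest time `(Θᵢ x)⁰ − s → −∞`, so clause (ℓ) fails. [folklore] -/
theorem not_antiOrthochronous_of_ell (d : StationaryFinalStateDecomposition 𝓢 O k) {M a c r₀ : Fin d.N → ℝ}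
    {Θ : Fin d.N → E4 → E4} (i : Fin d.N)
    (hW : IsKerrChartedWith (d.hole i) (d.adapted i) (M i) (a i) (c i) (r₀ i) (Θ i)) (hc1 : c i = 1)
    (he' : Tendsto (d.toOver.excision i) atTop atTop)
    (hℓ : ∃ T : ℝ, ∀ y : (d.background i).domain, T < (y : E4) 0 →
      (d.background i).radius y.1 ≤ d.toOver.excision i ((y : E4) 0) + 1 → d.toOver.τ₀ < (d.background i).time y.1)
    (hγ : ((d.motion i).1 : E4 ≃L[ℝ] E4) (E4.basisVector 0) 0 ≤ -1) : False := by
  -- adapted from `not_timeReversing_of_ell` (…RecutCoreCOIsochronousSign, unbuilt today)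
  obtain ⟨T, hT⟩ := hℓ
  obtain ⟨hsub, -, -, hr₀, -, -, hΘm, hΘe, -⟩ := hW
  have hrp : 0 < Kerr.rPlus (M i) (a i) := hsub.pos.trans_le (le_add_of_nonneg_right (Real.sqrt_nonneg _))
  have hsubreg : (Kerr.exterior (M i) (a i) : Set E4) ⊆ (Kerr.region (a i) (r₀ i) : Set E4) := fun z hz ↦
    Kerr.mem_region.2 ((max_le_max hr₀.le le_rfl).trans_lt (Kerr.mem_exterior.1 hz))
  -- a point of the exterior and its adapted radius
  obtain ⟨x, hxr⟩ := exists_radius_ge_w7 (a i) (Kerr.rPlus (M i) (a i) + 1)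
  have hx : x ∈ (Kerr.exterior (M i) (a i) : Set E4) := Kerr.mem_exterior.2 ((max_eq_left hrp.le).trans_lt (by linarith))
  set a₀ : ℝ := (d.adapted i).radius (Θ i x) with ha₀
  obtain ⟨T', hT'⟩ := eventually_atTop.1 (he'.eventually_ge_atTop (a₀ - 1))
  set Λ : lorentzGroup := (d.motion i).1 with hΛ
  set b₀ : ℝ := ((Λ : E4 ≃L[ℝ] E4) (Θ i x) + (d.motion i).2) 0 with hb₀
  -- slide backwards in Kerr–Schild time by `s`
  set s : ℝ := max (max (T - b₀ + 1) (T' - b₀)) (max (Θ i x 0 - d.toOver.τ₀) 0) with hs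
  have hs1 : T - b₀ + 1 ≤ s := (le_max_left _ _).trans (le_max_left _ _)
  have hs2 : T' - b₀ ≤ s := (le_max_right _ _).trans (le_max_left _ _)
  have hs3 : Θ i x 0 - d.toOver.τ₀ ≤ s := (le_max_left _ _).trans (le_max_right _ _)
  have hs0 : 0 ≤ s := (le_max_right _ _).trans (le_max_right _ _)
  have hxs : x + (-s) • E4.basisVector 0 ∈ (Kerr.exterior (M i) (a i) : Set E4) :=
    Kerr.add_smul_basisVector_zero_mem_region hx (-s)
  have hΘxs : Θ i (x + (-s) • E4.basisVector 0) = Θ i x + (-s) • E4.basisVector 0 := by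
    have h := hΘe x (hsubreg hx) (-s); rwa [hc1, one_mul] at h
  set ys : E4 := (Λ : E4 ≃L[ℝ] E4) (Θ i (x + (-s) • E4.basisVector 0)) + (d.motion i).2 with hys
  have hysdom : ys ∈ (d.background i).domain := by
    show poincareInv (d.motion i).1 (d.motion i).2 ys ∈ ((d.adapted i).domain : Set E4)
    rw [hys, poincareInv_apply_add]; exact hΘm (hsubreg hxs)
  have he00 : (E4.basisVector 0 : E4) 0 = 1 := by simp [E4.basisVector]
  have hlab : ys 0 = b₀ - s * (Λ : E4 ≃L[ℝ] E4) (E4.basisVector 0) 0 := by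
    rw [hys, hΘxs, map_add, map_smul, hb₀, PiLp.add_apply, PiLp.add_apply, PiLp.add_apply, PiLp.smul_apply,
      smul_eq_mul]
    ring
  have hlab' : b₀ + s ≤ ys 0 := by rw [hlab]; nlinarith
  have hrest : (d.background i).time ys = Θ i x 0 - s := by
    show poincareInv (d.motion i).1 (d.motion i).2 ys 0 = _
    rw [hys, poincareInv_apply_add, hΘxs, PiLp.add_apply, PiLp.smul_apply, he00]; ring
  have hrad : (d.background i).radius ys = a₀ := by
    show (d.adapted i).radius (poincareInv (d.motion i).1 (d.motion i).2 ys) = a₀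
    rw [hys, poincareInv_apply_add, hΘxs, adaptedRadius_add_smul_basisVector]
  have h := hT ⟨ys, hysdom⟩ (by linarith) (by
    rw [hrad]
    linarith [hT' (ys 0) (by linarith)])
  rw [hrest] at h
  linarith

/-- **Registered helper `recutJunction_orthochronous` (wave 7, brick B1 support)**: under Kerr identifications with
`cᵢ = 1`, clause (e′) (`ρᵢ → ∞`) and clause (ℓ) (lab-late coordinates within the excision scale are rest-late), every
motion is orthochronous with Lorentz factor `γᵢ = (Λᵢ e₀)⁰ ≥ 1` (`γᵢ² ≥ 1` always; `γᵢ ≤ −1` is excluded by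
`not_antiOrthochronous_of_ell`). This supplies `IsOrientationCompatible` (i), which is NOT among the core's binders.
[folklore] -/
theorem recutJunction_orthochronous : ∀ {𝓢 : Spacetime.{0} 4} {O : Set 𝓢.carrier} {k : ℕ} (d : StationaryFinalStateDecomposition 𝓢 O k) (M a c r₀ : Fin d.N → ℝ) (Θ : Fin d.N → E4 → E4), (∀ i, IsKerrChartedWith (d.hole i) (d.adapted i) (M i) (a i) (c i) (r₀ i) (Θ i)) → (∀ i, c i = 1) → (∀ i : Fin d.N, Tendsto (d.toOver.excision i) atTop atTop) → (∀ i : Fin d.N, ∃ T : ℝ, ∀ y : (d.background i).domain, T < (y : E4) 0 → (d.background i).radius y.1 ≤ d.toOver.excision i ((y : E4) 0) + 1 → d.toOver.τ₀ < (d.background i).time y.1) → ∀ i : Fin d.N, 1 ≤ ((d.motion i).1 : E4 ≃L[ℝ] E4) (E4.basisVector 0) 0 := by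
  intro 𝓢 O k d M a c r₀ Θ hW hc1 he' hℓ i
  by_contra hlt
  push Not at hlt
  have hsq := one_le_lorentz_basisVector_zero_sq_w7 (d.motion i).1
  have hle : ((d.motion i).1 : E4 ≃L[ℝ] E4) (E4.basisVector 0) 0 ≤ -1 := by nlinarith
  exact not_antiOrthochronous_of_ell d i (hW i) (hc1 i) (he' i) (hℓ i) hle

end Ortho

/-! ## §3 Lab time of (certified) hole coordinates -/

section LabTime

variable {𝓢 : Spacetime.{0} 4} {O : Set 𝓢.carrier} {k : ℕ}

/-- **Registered helper `recutJunction_labTime_sandwich` (brick B1a, pointwise form)**: for every hole `i` there is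
`C ≥ 0` with `|y⁰ − cᵢ⁰ − γᵢ · timeᵢ y| ≤ uᵢ (radiusᵢ y + C)` for EVERY `y : E4` (`γᵢ = (Λᵢ e₀)⁰`, `uᵢ = √(γᵢ² − 1)`;
the Lorentz sandwich applied to `Λᵢ⁻¹(y − cᵢ)`, whose spatial norm is within `C` of the adapted radius). In particular a
certified coordinate of rest time `t` has lab time in `γᵢ t + cᵢ⁰ ± uᵢ (Rᵢ t + C)`. [folklore] -/
theorem recutJunction_labTime_sandwich : ∀ {𝓢 : Spacetime.{0} 4} {O : Set 𝓢.carrier} {k : ℕ} (d : StationaryFinalStateDecomposition 𝓢 O k) (i : Fin d.N), ∃ C : ℝ, 0 ≤ C ∧ ∀ y : E4, |y 0 - (d.motion i).2 0 - ((d.motion i).1 : E4 ≃L[ℝ] E4) (E4.basisVector 0) 0 * (d.background i).time y| ≤ √((((d.motion i).1 : E4 ≃L[ℝ] E4) (E4.basisVector 0) 0) ^ 2 - 1) * ((d.background i).radius y + C) := by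
  intro 𝓢 O k d i
  obtain ⟨C, hC⟩ := (d.adapted i).exists_abs_radius_sub_spatialNorm_le
  refine ⟨|C|, abs_nonneg C, fun y ↦ ?_⟩
  have h := poincareInv_time_sandwich_w7 (d.motion i).1 (d.motion i).2 y
  have h1 : E4.spatialNorm (poincareInv (d.motion i).1 (d.motion i).2 y) ≤
      (d.adapted i).radius (poincareInv (d.motion i).1 (d.motion i).2 y) + |C| := by
    have h2 := (abs_le.1 (hC (poincareInv (d.motion i).1 (d.motion i).2 y))).1
    linarith [le_abs_self C]
  show |y 0 - (d.motion i).2 0 - _ * poincareInv (d.motion i).1 (d.motion i).2 y 0| ≤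
    _ * ((d.adapted i).radius (poincareInv (d.motion i).1 (d.motion i).2 y) + |C|)
  exact h.trans (mul_le_mul_of_nonneg_left h1 (Real.sqrt_nonneg _))

/-- **Registered helper `recutJunction_labTime_of_certified` (brick B1a, eventual form; W17 §7.2 Step 0)**: with SUBLINEAR
radii `Rᵢ τ / τ → 0`, for every `ε > 0`, eventually in the rest time `t`, every certified coordinate `y` of hole `i`
(`timeᵢ y = t`, `radiusᵢ y ≤ Rᵢ t`) has lab time within `ε t` of `γᵢ t`: `|y⁰ − γᵢ t| ≤ ε t`. (With `1 ≤ γᵢ ≤ γ_max`: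
an old certified slab point of rest time `τ₂ = τ₁/(2γ_max)` has lab time `≤ τ₁/2 + ε τ₂ < τ₁` and `≥ (1 − ε) τ₂`.)
[folklore] -/
theorem recutJunction_labTime_of_certified : ∀ {𝓢 : Spacetime.{0} 4} {O : Set 𝓢.carrier} {k : ℕ} (d : StationaryFinalStateDecomposition 𝓢 O k) (R : Fin d.N → ℝ → ℝ) (i : Fin d.N), Tendsto (fun τ ↦ R i τ / τ) atTop (𝓝 0) → ∀ ε : ℝ, 0 < ε → ∀ᶠ t in atTop, ∀ y : E4, (d.background i).time y = t → (d.background i).radius y ≤ R i t → |y 0 - ((d.motion i).1 : E4 ≃L[ℝ] E4) (E4.basisVector 0) 0 * t| ≤ ε * t := by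
  intro 𝓢 O k d R i hRo ε hε
  obtain ⟨C, hC0, hC⟩ := recutJunction_labTime_sandwich d i
  set γ : ℝ := ((d.motion i).1 : E4 ≃L[ℝ] E4) (E4.basisVector 0) 0 with hγ
  set u : ℝ := √(γ ^ 2 - 1) with hu
  have hu0 : 0 ≤ u := Real.sqrt_nonneg _
  set c₀ : ℝ := (d.motion i).2 0 with hc₀
  have hδ : 0 < ε / (2 * (u + 1)) := by positivity
  have h1 : ∀ᶠ t in atTop, |R i t / t| ≤ ε / (2 * (u + 1)) := by
    have h := (Metric.tendsto_nhds.1 hRo) _ hδ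
    filter_upwards [h] with t ht
    rw [Real.dist_eq, sub_zero] at ht
    exact ht.le
  filter_upwards [h1, eventually_gt_atTop (0 : ℝ), eventually_ge_atTop (2 * (|c₀| + u * C) / ε)] with t ht ht0 ht1 y hyt hyR
  have h2 : |R i t| ≤ ε / (2 * (u + 1)) * t := by
    rw [abs_div, abs_of_pos ht0, div_le_iff₀ ht0] at ht
    exact ht
  have h3 : u * R i t ≤ ε * t / 2 := by
    have h4 : u * R i t ≤ u * |R i t| := mul_le_mul_of_nonneg_left (le_abs_self _) hu0
    have h5 : u * |R i t| ≤ (u + 1) * |R i t| := by nlinarith [abs_nonneg (R i t)]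
    have h6 : (u + 1) * (ε / (2 * (u + 1)) * t) = ε * t / 2 := by field_simp
    nlinarith [mul_le_mul_of_nonneg_left h2 (by positivity : (0 : ℝ) ≤ u + 1)]
  have h7 : |c₀| + u * C ≤ ε * t / 2 := by
    rw [div_le_iff₀ hε] at ht1
    linarith
  have h8 := hC y
  rw [hyt] at h8
  have h9 : u * ((d.background i).radius y + C) ≤ u * (R i t + C) :=
    mul_le_mul_of_nonneg_left (by linarith) hu0
  rw [abs_le] at h8 ⊢
  constructor
  · nlinarith [h8.1, neg_abs_le c₀]
  · nlinarith [h8.2, le_abs_self c₀]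

/-- **Registered helper `recutJunction_time_le_labTime` (brick B1b; W17 §5.3, §7.2 F1/F1b)**: for an orthochronous motion
(`γᵢ ≥ 1`) and monotone SUBLINEAR radii, eventually in the LAB time `y⁰`, every certified coordinate `y` of hole `i`
(`radiusᵢ y ≤ Rᵢ (timeᵢ y)`) has rest time `timeᵢ y ≤ y⁰ + |cᵢ⁰| + 1` (for `γᵢ = 1` exactly `timeᵢ y ≤ y⁰ − cᵢ⁰`; for
`γᵢ > 1` the room `(γᵢ − 1) timeᵢ y` absorbs `uᵢ (Rᵢ (timeᵢ y) + C)`). Replaces isochrony in the Ω-test and in Step F.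
[folklore] -/
theorem recutJunction_time_le_labTime : ∀ {𝓢 : Spacetime.{0} 4} {O : Set 𝓢.carrier} {k : ℕ} (d : StationaryFinalStateDecomposition 𝓢 O k) (R : Fin d.N → ℝ → ℝ) (i : Fin d.N), Monotone (R i) → Tendsto (fun τ ↦ R i τ / τ) atTop (𝓝 0) → 1 ≤ ((d.motion i).1 : E4 ≃L[ℝ] E4) (E4.basisVector 0) 0 → ∃ T : ℝ, ∀ y : E4, T ≤ y 0 → (d.background i).radius y ≤ R i ((d.background i).time y) → (d.background i).time y ≤ y 0 + |(d.motion i).2 0| + 1 := by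
  intro 𝓢 O k d R i hRmono hRo hγ1
  obtain ⟨C, hC0, hC⟩ := recutJunction_labTime_sandwich d i
  set γ : ℝ := ((d.motion i).1 : E4 ≃L[ℝ] E4) (E4.basisVector 0) 0 with hγ
  set u : ℝ := √(γ ^ 2 - 1) with hu
  have hu0 : 0 ≤ u := Real.sqrt_nonneg _
  set c₀ : ℝ := (d.motion i).2 0 with hc₀
  -- a rest-time threshold `T₁` beyond which `u (R t + C) ≤ (γ − 1) t + 1`
  obtain ⟨T₁, hT₁⟩ : ∃ T₁ : ℝ, ∀ t, T₁ ≤ t → u * (R i t + C) ≤ (γ - 1) * t + 1 := by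
    rcases hγ1.eq_or_lt with h1 | h1
    · refine ⟨0, fun t _ ↦ ?_⟩
      have hu' : u = 0 := by rw [hu, ← h1]; simp
      rw [hu', ← h1]; simp
    · have hg : 0 < γ - 1 := by linarith
      have hδ : 0 < (γ - 1) / (2 * (u + 1)) := by positivity
      have h2 : ∀ᶠ t in atTop, |R i t / t| ≤ (γ - 1) / (2 * (u + 1)) := by
        have h := (Metric.tendsto_nhds.1 hRo) _ hδ
        filter_upwards [h] with t ht
        rw [Real.dist_eq, sub_zero] at ht
        exact ht.le
      obtain ⟨T₁, hT₁⟩ := eventually_atTop.1 (h2.and ((eventually_gt_atTop (0 : ℝ)).and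
        (eventually_ge_atTop (2 * u * C / (γ - 1)))))
      refine ⟨T₁, fun t ht ↦ ?_⟩
      obtain ⟨h3, ht0, ht1⟩ := hT₁ t ht
      have h4 : |R i t| ≤ (γ - 1) / (2 * (u + 1)) * t := by
        rw [abs_div, abs_of_pos ht0, div_le_iff₀ ht0] at h3
        exact h3
      have h5 : u * R i t ≤ (γ - 1) * t / 2 := by
        have h6 : u * R i t ≤ u * |R i t| := mul_le_mul_of_nonneg_left (le_abs_self _) hu0
        have h7 : u * |R i t| ≤ (u + 1) * |R i t| := by nlinarith [abs_nonneg (R i t)]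
        have h8 : (u + 1) * ((γ - 1) / (2 * (u + 1)) * t) = (γ - 1) * t / 2 := by field_simp
        nlinarith [mul_le_mul_of_nonneg_left h4 (by positivity : (0 : ℝ) ≤ u + 1)]
      have h9 : u * C ≤ (γ - 1) * t / 2 := by
        rw [div_le_iff₀ hg] at ht1
        linarith
      nlinarith
  refine ⟨T₁, fun y hy hcert ↦ ?_⟩
  set t : ℝ := (d.background i).time y with ht
  by_cases hcase : t < T₁
  · linarith [abs_nonneg c₀]
  · push Not at hcase
    have h1 := (abs_le.1 (hC y)).1
    have h2 : u * ((d.background i).radius y + C) ≤ u * (R i t + C) :=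
      mul_le_mul_of_nonneg_left (by linarith) hu0
    have h3 := hT₁ t hcase
    rw [← ht] at h1
    linarith [le_abs_self c₀, neg_abs_le c₀]

/-- **Registered helper `recutJunction_time_ge_of_labTime` (brick B1a, lateness transfer; W17 §7.2 F1)**: for an
orthochronous motion (`γᵢ ≥ 1`) and monotone radii, for every `T*`, eventually in the LAB time `y⁰`, every certified
coordinate `y` of hole `i` has rest time `timeᵢ y ≥ T*` (`y⁰ ≤ γᵢ t + cᵢ⁰ + uᵢ (Rᵢ t + C)` is bounded on `{t ≤ T*}`).
So lab-late exits of flat verticals are rest-late. [folklore] -/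
theorem recutJunction_time_ge_of_labTime : ∀ {𝓢 : Spacetime.{0} 4} {O : Set 𝓢.carrier} {k : ℕ} (d : StationaryFinalStateDecomposition 𝓢 O k) (R : Fin d.N → ℝ → ℝ) (i : Fin d.N), Monotone (R i) → 1 ≤ ((d.motion i).1 : E4 ≃L[ℝ] E4) (E4.basisVector 0) 0 → ∀ Tstar : ℝ, ∃ T : ℝ, ∀ y : E4, T ≤ y 0 → (d.background i).radius y ≤ R i ((d.background i).time y) → Tstar ≤ (d.background i).time y := by
  intro 𝓢 O k d R i hRmono hγ1 Tstar
  obtain ⟨C, hC0, hC⟩ := recutJunction_labTime_sandwich d i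
  set γ : ℝ := ((d.motion i).1 : E4 ≃L[ℝ] E4) (E4.basisVector 0) 0 with hγ
  set u : ℝ := √(γ ^ 2 - 1) with hu
  have hu0 : 0 ≤ u := Real.sqrt_nonneg _
  set c₀ : ℝ := (d.motion i).2 0 with hc₀
  refine ⟨γ * max Tstar 0 + c₀ + u * (|R i Tstar| + C) + 1, fun y hy hcert ↦ ?_⟩
  set t : ℝ := (d.background i).time y with ht
  by_contra hlt
  push Not at hlt
  have h1 := (abs_le.1 (hC y)).2
  rw [← ht] at h1
  have h2 : R i t ≤ |R i Tstar| := (hRmono hlt.le).trans (le_abs_self _)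
  have h3 : u * ((d.background i).radius y + C) ≤ u * (|R i Tstar| + C) :=
    mul_le_mul_of_nonneg_left (by linarith) hu0
  have h4 : γ * t ≤ γ * max Tstar 0 := by
    have h5 : t ≤ max Tstar 0 := hlt.le.trans (le_max_left _ _)
    nlinarith
  linarith

end LabTime

end Summit.FinalStateConjecture.FinalStateConjecture.Theorems.SymplecticDualOfTheBomb

end
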